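import Summits.ResolutionOfSingularities.ResolutionOfSingularities.Theorems.FrobeniusLadderFInjectiveMacaulayficationOmegaOneCureFanCert
import HarnessLib

/-!
# Ω₁ KERNEL ROW, DATA SIDE — the STRENGTHENED exit check of RULING R23.12 (1): code 5 (resp. 6) of ✓p694236 is READ with the p-free letter conjunct «∃ i ∈ Z, M₁ i ≠ 0 ∧ r i = 0»
# (resp. `s i = 0`) under which ✓p699830 `fullCl_pencilChartW_code5/6` is sound at EVERY point `w₀` of the fibre line; re-certified on the three cure fans by `decide +kernel`
# (crux `FInjectiveMacaulayfication` stmt-ResolutionOfSingularities-15315, chain w45a; res-L1-w45a-plan-1 RULING R23.12 (1) «a strengthened boolean `exitOK'`/`checkExits'` in a NEW file,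
# certified by `decide` on the three fans; the list bridge targets `checkExits'`»; consumer res-L1-w45a-stub-3 TASK 4c; seat res-L1-w45a-stub-1 g15 (hands offered l.85835))

[OURS · L1 W4.5a] Support file (`--supports stmt-ResolutionOfSingularities-15315 --as helper`); two Boolean list programs + three `decide +kernel` certificates + the Boolean unpacking
lemma; no named fact; NOT a statement of any manuscript; nothing of the crux is proved. The certified tables `RAYS_*`, `CONES_*`, `TAGS_*` of ✓p694236 are imported, NOT copied or
modified. AI-written (AI review weaker than expert review).
* `isoLetter` (the conjunct, recomputed from the rays exactly as `exitOK` computes `M₁, r, s`), `exitOK'` (`= exitOK && conjunct` on codes 5/6, `= exitOK` otherwise), `checkExits'`;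
  `exitOK_of_exitOK'`, `isoLetter_of_exitOK'_five/_six` (unpacking); ★ `cert'_G9`, ★ `cert'_G10`, ★ `cert'_G10Q` (all 259 + 455 + 975 (cone, orbit) pairs pass; the 181 code-5 pairs
  of G10Q all carry the letter).
[folklore toric bookkeeping; cite: CoxLittleSchenck2011, §2.3; Fedder1983, Thm. 1.12]
-/

set_option linter.dupNamespace false

namespace Summit.ResolutionOfSingularities.ResolutionOfSingularities.Theorems.FInjectiveMacaulayfication.OmegaOneCureFanCertStrong

open Summit.ResolutionOfSingularities.ResolutionOfSingularities.Theorems.FInjectiveMacaulayfication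
open FanCheckKit OmegaOneCureFanCert

/-! ## §1 The strengthened check -/

/-- **THE LETTER CONJUNCT** at one (cone, orbit): recompute `M₁, r, s` from the cone rows exactly as `exitOK` does and test «some `i ∈ Z` has `M₁ i > 0` and `r i = 0`» (`useS = false`)
resp. «… and `s i = 0`» (`useS = true`). [OURS · bookkeeping of R23.12 (1)] -/
def isoLetter (e CI : ℕ) (P Q : List ℕ) (rows : List (List ℕ)) (Z : List ℕ) (useS : Bool) : Bool :=
  let C := rows.map fun ρ => e * getL ρ CI 0
  let A := rows.map fun ρ => dotL ρ P
  let B := rows.map fun ρ => dotL ρ Q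
  let m := vmin A B
  let r := vsub A m
  let s := vsub B m
  let G := vmin C m
  let M1 := vsub C G
  let v := if useS then s else r
  Z.any fun i => Nat.blt 0 (getL M1 i 0) && Nat.beq (getL v i 0) 0

/-- ★ **THE STRENGTHENED EXIT CHECK**: `exitOK` of ✓p694236 AND, on code 5 (resp. 6), the letter conjunct. [OURS · R23.12 (1)] -/
def exitOK' (n e CI : ℕ) (P Q : List ℕ) (rows : List (List ℕ)) (Z : List ℕ) (t : ℕ) : Bool :=
  exitOK n e CI P Q rows Z t &&
    match t with
    | 5 => isoLetter e CI P Q rows Z false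
    | 6 => isoLetter e CI P Q rows Z true
    | _ => true

/-- All (cone, orbit) pairs pass the strengthened check. [bookkeeping] -/
def checkExits' (n e CI : ℕ) (P Q : List ℕ) (RAYS : List (List ℕ)) (CONES : List (List ℕ)) (ORB : List (List ℕ)) (TAGS : List (List ℕ)) : Bool :=
  Nat.beq CONES.length TAGS.length && (CONES.zip TAGS).all fun ct =>
    Nat.beq ORB.length ct.2.length && (ORB.zip ct.2).all fun zt => exitOK' n e CI P Q (raysOf RAYS ct.1) zt.1 zt.2

/-! ## §2 Unpacking -/

/-- `exitOK'` implies `exitOK`. [plumbing] -/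
theorem exitOK_of_exitOK' (n e CI : ℕ) (P Q : List ℕ) (rows : List (List ℕ)) (Z : List ℕ) (t : ℕ) (h : exitOK' n e CI P Q rows Z t = true) :
    exitOK n e CI P Q rows Z t = true := by
  unfold exitOK' at h
  exact (Bool.and_eq_true_iff.1 h).1

/-- On code 5, `exitOK'` carries the `r`-letter conjunct. [plumbing] -/
theorem isoLetter_of_exitOK'_five (n e CI : ℕ) (P Q : List ℕ) (rows : List (List ℕ)) (Z : List ℕ) (h : exitOK' n e CI P Q rows Z 5 = true) :
    isoLetter e CI P Q rows Z false = true := by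
  unfold exitOK' at h
  exact (Bool.and_eq_true_iff.1 h).2

/-- On code 6, `exitOK'` carries the `s`-letter conjunct. [plumbing] -/
theorem isoLetter_of_exitOK'_six (n e CI : ℕ) (P Q : List ℕ) (rows : List (List ℕ)) (Z : List ℕ) (h : exitOK' n e CI P Q rows Z 6 = true) :
    isoLetter e CI P Q rows Z true = true := by
  unfold exitOK' at h
  exact (Bool.and_eq_true_iff.1 h).2

/-- `checkExits'` unpacks to `exitOK'` at every (cone, orbit) pair, indexwise. [plumbing] -/
theorem exitOK'_of_checkExits' (n e CI : ℕ) (P Q : List ℕ) (RAYS : List (List ℕ)) (CONES : List (List ℕ)) (ORB : List (List ℕ)) (TAGS : List (List ℕ))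
    (h : checkExits' n e CI P Q RAYS CONES ORB TAGS = true) (ct : List ℕ × List ℕ) (hct : ct ∈ CONES.zip TAGS) (zt : List ℕ × ℕ) (hzt : zt ∈ ORB.zip ct.2) :
    exitOK' n e CI P Q (raysOf RAYS ct.1) zt.1 zt.2 = true := by
  unfold checkExits' at h
  have h1 := (Bool.and_eq_true_iff.1 h).2
  rw [List.all_eq_true] at h1
  have h2 := (Bool.and_eq_true_iff.1 (h1 ct hct)).2
  rw [List.all_eq_true] at h2
  exact h2 zt hzt

/-! ## §3 ★ The certificates -/

/-- ★ **G9 passes the strengthened check** (`e = 22`; no code 5/6 occurs — identical in content to ✓p694236 `cert_G9`'s last conjunct). One `decide +kernel`. -/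
theorem cert'_G9 : checkExits' 3 22 2 [2, 0, 0] [0, 3, 0] RAYS_G9 CONES_G9 ORB3 TAGS_G9 = true := by
  decide +kernel

/-- ★ **G10 passes the strengthened check** (`e = 43`; no code 5/6 occurs). One `decide +kernel`. -/
theorem cert'_G10 : checkExits' 3 43 2 [2, 0, 0] [0, 3, 0] RAYS_G10 CONES_G10 ORB3 TAGS_G10 = true := by
  decide +kernel

/-- ★ **G10Q passes the strengthened check** (`e = 43`; all 181 code-5 pairs carry the letter «∃ i ∈ Z, M₁ i > 0 ∧ r i = 0»). One `decide +kernel`. -/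
theorem cert'_G10Q : checkExits' 4 43 3 [1, 2, 0, 0] [0, 0, 3, 0] RAYS_G10Q CONES_G10Q ORB4 TAGS_G10Q = true := by
  decide +kernel

/-! ## §4 (v2) The WEIGHTED-BOUNDARY variant for model #4 «G9∧10» (two boundary letters; res-L1-w45a-tri-2 g21 break-test l.86119, fan Σ₄ `omega_fan_cross5_cert.json` 047fa4ba1b3417b8:
`C(ρ) = 22·ρ₂ + 43·ρ₃`, i.e. `CW = [0,0,22,43]`; RULING R23.17 (2): the Σ₄ tables and the `decide` certificate stay with res-L1-w45a-stub-3's kernel row) -/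

/-- **THE (†) EXIT WITNESS CHECK WITH A WEIGHTED BOUNDARY**: as `exitOK` of ✓p694236 but with `C := rows.map (fun ρ => ⟨ρ, CW⟩)` for a weight vector `CW` (several boundary letters with
their exponents) in place of `e·ρ[CI]`. [OURS · bookkeeping] -/
def exitOKW (n : ℕ) (CW P Q : List ℕ) (rows : List (List ℕ)) (Z : List ℕ) (t : ℕ) : Bool :=
  let C := rows.map fun ρ => dotL ρ CW
  let A := rows.map fun ρ => dotL ρ P
  let B := rows.map fun ρ => dotL ρ Q
  let m := vmin A B
  let r := vsub A m
  let s := vsub B m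
  let G := vmin C m
  let M1 := vsub C G
  let M2 := vsub m G
  let U := (List.range n).filter fun i => !(Z.any fun j => Nat.beq j i)
  let rZ := (onZ Z r).any fun x => Nat.blt 0 x
  let sZ := (onZ Z s).any fun x => Nat.blt 0 x
  let deep := rZ && sZ
  let nonpdiv := rZ || sZ || U.any fun i =>
    let d := (getL r i 0 - getL s i 0) + (getL s i 0 - getL r i 0)
    Nat.ble 1 d && Nat.ble d 4
  match t with
  | 0 => allLe (onZ Z M1) 0
  | 1 => !deep && nonpdiv && allLe (onZ Z M2) 1
  | 2 => !deep && nonpdiv && allLe (onZ Z M1) 1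
  | 3 => !deep && nonpdiv && allLe (onZ Z M1) 2 && allLe (onZ Z M2) 2
  | 4 => deep && allLe (onZ Z M1) 1
  | 5 => deep && allLe (vadd (onZ Z M2) (onZ Z r)) 1
  | 6 => deep && allLe (vadd (onZ Z M2) (onZ Z s)) 1
  | 7 => deep && allLe (vadd (vadd (onZ Z M1) (onZ Z M2)) (onZ Z r)) 2
  | 8 => deep && allLe (vadd (vadd (onZ Z M1) (onZ Z M2)) (onZ Z s)) 2
  | _ => false

/-- The code-5/6 letter conjunct with a weighted boundary. [OURS · bookkeeping] -/
def isoLetterW (CW P Q : List ℕ) (rows : List (List ℕ)) (Z : List ℕ) (useS : Bool) : Bool :=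
  let C := rows.map fun ρ => dotL ρ CW
  let A := rows.map fun ρ => dotL ρ P
  let B := rows.map fun ρ => dotL ρ Q
  let m := vmin A B
  let r := vsub A m
  let s := vsub B m
  let G := vmin C m
  let M1 := vsub C G
  let v := if useS then s else r
  Z.any fun i => Nat.blt 0 (getL M1 i 0) && Nat.beq (getL v i 0) 0

/-- ★ **THE STRENGTHENED WEIGHTED CHECK** `exitOKW' = exitOKW ∧ (codes 5/6 ⇒ letter conjunct)`. [OURS · R23.12 (1) in the weighted letter] -/
def exitOKW' (n : ℕ) (CW P Q : List ℕ) (rows : List (List ℕ)) (Z : List ℕ) (t : ℕ) : Bool :=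
  exitOKW n CW P Q rows Z t &&
    match t with
    | 5 => isoLetterW CW P Q rows Z false
    | 6 => isoLetterW CW P Q rows Z true
    | _ => true

/-- All (cone, orbit) pairs pass the strengthened weighted check. [bookkeeping] -/
def checkExitsW' (n : ℕ) (CW P Q : List ℕ) (RAYS : List (List ℕ)) (CONES : List (List ℕ)) (ORB : List (List ℕ)) (TAGS : List (List ℕ)) : Bool :=
  Nat.beq CONES.length TAGS.length && (CONES.zip TAGS).all fun ct =>
    Nat.beq ORB.length ct.2.length && (ORB.zip ct.2).all fun zt => exitOKW' n CW P Q (raysOf RAYS ct.1) zt.1 zt.2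

/-- `exitOKW'` implies `exitOKW`. [plumbing] -/
theorem exitOKW_of_exitOKW' (n : ℕ) (CW P Q : List ℕ) (rows : List (List ℕ)) (Z : List ℕ) (t : ℕ) (h : exitOKW' n CW P Q rows Z t = true) :
    exitOKW n CW P Q rows Z t = true := by
  unfold exitOKW' at h
  exact (Bool.and_eq_true_iff.1 h).1

/-- On code 5, `exitOKW'` carries the `r`-letter conjunct. [plumbing] -/
theorem isoLetterW_of_exitOKW'_five (n : ℕ) (CW P Q : List ℕ) (rows : List (List ℕ)) (Z : List ℕ) (h : exitOKW' n CW P Q rows Z 5 = true) :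
    isoLetterW CW P Q rows Z false = true := by
  unfold exitOKW' at h
  exact (Bool.and_eq_true_iff.1 h).2

/-- On code 6, `exitOKW'` carries the `s`-letter conjunct. [plumbing] -/
theorem isoLetterW_of_exitOKW'_six (n : ℕ) (CW P Q : List ℕ) (rows : List (List ℕ)) (Z : List ℕ) (h : exitOKW' n CW P Q rows Z 6 = true) :
    isoLetterW CW P Q rows Z true = true := by
  unfold exitOKW' at h
  exact (Bool.and_eq_true_iff.1 h).2

/-- `checkExitsW'` unpacks to `exitOKW'` at every (cone, orbit) pair. [plumbing] -/
theorem exitOKW'_of_checkExitsW' (n : ℕ) (CW P Q : List ℕ) (RAYS : List (List ℕ)) (CONES : List (List ℕ)) (ORB : List (List ℕ)) (TAGS : List (List ℕ))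
    (h : checkExitsW' n CW P Q RAYS CONES ORB TAGS = true) (ct : List ℕ × List ℕ) (hct : ct ∈ CONES.zip TAGS) (zt : List ℕ × ℕ) (hzt : zt ∈ ORB.zip ct.2) :
    exitOKW' n CW P Q (raysOf RAYS ct.1) zt.1 zt.2 = true := by
  unfold checkExitsW' at h
  have h1 := (Bool.and_eq_true_iff.1 h).2
  rw [List.all_eq_true] at h1
  have h2 := (Bool.and_eq_true_iff.1 (h1 ct hct)).2
  rw [List.all_eq_true] at h2
  exact h2 zt hzt

end Summit.ResolutionOfSingularities.ResolutionOfSingularities.Theorems.FInjectiveMacaulayfication.OmegaOneCureFanCertStrong
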